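import Summits.BirchSwinnertonDyer.Rank1Residual.GaloisImage.NonsplitMultiplicativeKummerTransport
import Literature.NumberTheory.EllipticCurves.LocalEulerCharacteristicTorsion
import Literature.NumberTheory.EllipticCurves.ZpExtensionUnramifiedProofs
import HarnessLib

/-!
# The local Weil cup product on `H¹(K_v, E[p])` at `v ∤ p`: the count `#H¹ = (#E(K_v)[p])²`,
# SYMMETRY, and isotropy of transported Kummer lines (cell `b2b-bsdres`, team n1011, row T-2LL
# "two Lagrangian lines", FILE 2b = the pairing half of KIND (vii); seat p04 GEN 11;
# skeleton `cells/n1011/skel/T-2LL.md`; referee-1 GEN 36 ACK-1 provisos (i)–(vii))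

HONEST FRAMING (cell `b2b-bsdres`, run/shared/lean/b2b/bsd-rank1-residual/, verbatim in every
file): the goal of the cell is to DELETE the COMBINATION-SHAPED residual classes of the
Birch–Swinnerton-Dyer formula for ALL analytic-rank `≤ 1` elliptic curves over `ℚ` — "full BSD
formula for every rank `≤ 1` curve in class `C`" assembled STRICTLY from published theorems — so
that the rank-`≤ 1` remainder becomes exactly the CONSTRUCTION-SHAPED classes, which are TYPED
(missing-input `Prop`s), NOT attempted. This is not "finishing BSD". Team n1011 (N10 / N11, the
additive block X4 ∧ `p = 3`): research route on the CONSTRUCTION-SHAPED class X4; no claim beyond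
the stated classes; nothing is booked; no mark / label / count is changed by this file. Theorems
only (no definition, no named fact, no `sorry`); NO named-fact hypothesis (the inputs are the
tree's PROVED local Euler characteristic in the prime-to-residue-characteristic case, the PROVED
local Tate duality for `E[n]`, the DISCHARGED Poonen–Rains isotropy, and the cell's T-E3g-ADD
theorems). Closes NO class by itself: it frees one more kind of place in a per-row visibility
certificate whose other inputs are EVIDENCE until kernel-certified.

## What

Kinds (i)–(vi), (iii′) of the tree's refined visibility certificate compare the local Selmer
conditions `𝓢_v(E)`, `θ_* 𝓢_v(E′)` of `p`-congruent curves (`θ : E′[p] ⥲ E[p]`) at places of good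
or (potentially) multiplicative reduction. KIND (vii) serves the places `v ∤ p` where BOTH curves
are ADDITIVE with a `K_v`-rational point of order `p` (`p = 3`: Kodaira IV / IV* with `c_v = 3` on
both sides) — route planner 1's FAIL-other class "add-pg/add-pg (v = 2)" of ROUTE-1 §41.3 and its
`v = 5, 7, 11, …` siblings, §44's L44 case `r = r′ = 1`. It is stated in THEOREM-SHAPED generality:

**`map_kummerLocalConditionAt_eq_of_inertia_torsion`** — `p` an odd prime, `v ∤ p`,
`#E(K_v)[p] = p` (`hcard`), and the INERTIA-TORSION hypotheses `hI`, `hI′`: every point of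
`E[p^∞](K̄)`, resp. `E′[p^∞](K̄)`, fixed by the inertia group of `K_v` is killed by `p` — in the
exact currency of the cell's `Additive.UnramifiedKummerDisjoint` (p06, T-E3g-ADD FILE A), DISCHARGED
at every ADDITIVE `v ∤ p`, `p` odd, by `Additive.inertia_torsion_of_hasAdditiveReductionAt`
(T-E3g-ADD FILE B; Kodaira–Néron over `K_v^nr`). THEN for every continuous `Γ_{K_v}`-intertwining
`f : E′[p]| → E[p]|` acting as `θ`:

  `(𝓛_v(E′)).map H¹(f) = 𝓛_v(E)`  (`𝓛_v = kummerLocalConditionAt`, the image of `E(K_v)/p`).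

Consequences: `h1Equiv_mem_selmerLocalKer_of_inertia_torsion` (`θ_* 𝓢_v(E′) ≤ 𝓢_v(E)`),
`relIndex_map_selmerLocalKer_eq_one_of_inertia_torsion` (`ι_v(θ) = 1`), and the transport
`natCard_ker_nsmul_eq_of_congr` (`#E(K_v)[p] = #E′(K_v)[p]`, so that a record may display the
partner's count; referee-1 proviso (i)).

## Proof ("a hyperbolic plane has exactly two isotropic lines")

With `H = H¹(K_v, E[p])` and the local Weil cup product `b = · ∪ₑ ·` (any Weil pairing `e`,
`exists_weilPairing_holds`):
* §1 `#H = (#E(K_v)[p])² = p²` (`natCard_galoisCohomology_one_torsion_eq_sq_of_not_mem`): Tate's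
  local Euler–Poincaré characteristic is a TREE THEOREM for modules of order prime to the residue
  characteristic (`natCard_invariants_mul_natCard_two_eq`), with `#H⁰ = #H² = #E(K_v)[p]`
  (`natCard_invariants_torsion_restrictField`, `natCard_galoisCohomology_two_torsion_restrictField`);
* §2 `b` is SYMMETRIC (`weilCupProduct_comm`: graded commutativity `ContPairing.cupProduct_comm` and
  `e` alternating, `weilPairingHom_add_swap_eq_zero`); it is non-degenerate
  (`eq_zero_of_forall_weilCupProduct_eq_zero`) and `H` is killed by `p`;
* `𝓛 = 𝓛_v(E)` has order `p` (`natCard_kummerLocalConditionAt_adicCompletion`, `#(𝓞_v/p) = 1`) and is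
  its own annihilator (`forall_mem_kummerLocalConditionAt_weilCupProduct_eq_zero_iff`, Poonen–Rains +
  the count);
* §3 `M = H¹(f)(𝓛_v(E′))` has order `p` (`NonsplitKummer.natCard_kummerLocalConditionAt_eq_of_congr`,
  `NonsplitKummer.map_injective_of_leftInverse`) and is ISOTROPIC
  (`cupProduct_map_map_eq_zero_of_mem_kummerLocalConditionAt`: Poonen–Rains for `E′` and the pulled
  back pairing `e ∘ (θ × θ)`, transported at the cocycle level);
* the unramified subgroup `U = H¹_ur(K_v, E[p])` meets `𝓛` trivially and contains some `u ∉ 𝓛`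
  (p06's `Additive.exists_mem_unramifiedSubgroup_not_mem_kummerLocalConditionAt_of_inertia_torsion_of_point`,
  from `hI` and a non-zero point of `E(K_v)[p]`), `u ∉ M` likewise (`hI′`, naturality
  `X11b.Levels.map_mem_unramifiedSubgroup`), and `b(u, u) = 0` (FILE 1,
  `cupProduct_restrict_eq_zero_of_mem_unramifiedSubgroup`: unramified classes are isotropic);
* §4 the finite-group lemma `LagrangianDichotomy.eq_of_isotropic_lines_of_isotropic_not_mem` (FILE 2a)
  concludes `M = 𝓛`.

No hypothesis on the reduction type, on `c_v`, on Kodaira symbols or on a witness point enters;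
`(p : 𝓞 K) ∉ v.asIdeal` and `hcard` are BINDERS (referee-1 provisos (iv), (v)).

## References

* [MilneADT2006] J. S. Milne, *Arithmetic Duality Theorems*, 2nd ed. (2006), Ch. I: Cor. 2.3,
  Prop. 2.6, Thm. 2.8, Lemma 2.9, Cor. 3.4, Lemma 3.3, Prop. 3.8.
* [PoonenRains2012] B. Poonen, E. Rains, *Random maximal isotropic subspaces and Selmer groups*,
  JAMS 25 (2012), Prop. 4.8, Cor. 4.6, Prop. 4.10–4.11.
* [MazurRubin2004] B. Mazur, K. Rubin, *Kolyvagin systems*, Mem. AMS 799 (2004), §2.3 (comparison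
  of Selmer structures); B. Mazur, K. Rubin, *Selmer companion curves*, Trans. AMS 367 (2015),
  Thm. 3.1 (iv), Lemma 20 — they compare at additive potentially good places through
  `E[p²] ≅ E′[p²]`; the present statement uses `E[p]` alone when `dim E[p]^{G_v} = 1`.
* [CremonaMazur2000] J. E. Cremona, B. Mazur, Experiment. Math. 9 (2000), §3.
* cells/n1011/ROUTE-1.md §41.3, §44 (planner r1: L44, ST-44a).

## Design

`noncomputable section`; §§1–3 universe-polymorphic (`K : Type u`), §4 at universe `0` (`K : Type`,
as the cell's comparison files and the x11a certificate, whose Tate facts are consumed at `.{0}`);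
cup products carry `[LocallyCompactSpace Γ_{K_v}]` as an instance BINDER in §§2–3 and obtain it in
§4 from the tree's `absoluteGaloisGroup_compactSpace` (no local instance attribute). Axioms:
`propext`, `Classical.choice`, `Quot.sound`.
-/

noncomputable section

open scoped Classical ContRepresentation
open CategoryTheory Function
open Field NumberField IsDedekindDomain WeierstrassCurve IsNonarchimedeanLocalField ValuativeRel
open Literature.NumberTheory.EllipticCurves Literature.NumberTheory.GaloisRepresentations

universe u

namespace Summit.BirchSwinnertonDyer.Rank1Residual.GaloisImage

namespace TwoLagrangianLines

open _root_.TopRep _root_.ContRepresentation _root_.ContinuousCohomology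

/-! ## §1 `#H¹(K_v, E[p]) = (#E(K_v)[p])²` at `v ∤ p` -/

section Count

variable {K : Type u} [Field K] [NumberField K] (W : WeierstrassCurve K) [W.IsElliptic]
  (v : HeightOneSpectrum (𝓞 K)) {p : ℕ} [hp : Fact p.Prime]

/-- **`#H¹(K_v, E[p]) = (#E(K_v)[p])²` at a finite place `v ∤ p`** (`p` prime): Tate's local
Euler–Poincaré characteristic formula `#H⁰ · #H² · (𝒪 : #M·𝒪) = #H¹` (Milne, *ADT*, I Thm. 2.8) is
a THEOREM of the tree for modules of order prime to the residue characteristic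
(`natCard_invariants_mul_natCard_two_eq`, Milne I Lemma 2.9: `χ = 1`), and
`#H⁰(K_v, E[p]) = #E(K_v)[p] = #H²(K_v, E[p])` (`natCard_invariants_torsion_restrictField`; local
duality in bidegree `(2,0)` + the Weil pairing, `natCard_galoisCohomology_two_torsion_restrictField`).
The residue characteristic of `K_v` is not `p` because `v ∤ p` (`ringChar_residueField_adicCompletion_ne`).
[cite: MilneADT2006, Ch. I §2, Thm. 2.8 and Lemma 2.9] -/
theorem natCard_galoisCohomology_one_torsion_eq_sq_of_not_mem (hpv : (p : 𝓞 K) ∉ v.asIdeal) :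
    Nat.card (galoisCohomology
        (GaloisRep.restrictField (v.adicCompletion K) (W.torsionGaloisModule (p : ℤ))) 1) =
      (Nat.card (nsmulAddMonoidHom p :
          (W.baseChange (v.adicCompletion K)).toAffine.Point →+ _).ker) ^ 2 := by
  haveI : CharZero (v.adicCompletion K) := charZero_adicCompletion v
  haveI : NeZero p := ⟨hp.out.ne_zero⟩
  haveI : Finite (geomTorsion W (p : ℤ)) := finite_geomTorsion_of_neZero W p
  haveI := absoluteGaloisGroup_compactSpace (v.adicCompletion K)
  set F := v.adicCompletion K with hF
  set ρ : ContinuousRep (absoluteGaloisGroup F) ℤ (geomTorsion W (p : ℤ)) :=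
    GaloisRep.restrictField F (W.torsionGaloisModule (p : ℤ)) with hρ
  have hA : IsPrimaryTorsion p (geomTorsion W (p : ℤ)) := fun T ↦
    ⟨1, by rw [pow_one]; exact AddSubgroup.torsionBy.nsmul T⟩
  have hℓ : p ≠ ringChar 𝓀[F] := (v.ringChar_residueField_adicCompletion_ne hpv).symm
  obtain ⟨-, hEq⟩ := natCard_invariants_mul_natCard_two_eq F ρ hA hℓ
  have h0 : Nat.card ρ.toTopRep.ρ.invariants =
      Nat.card (nsmulAddMonoidHom p : (W.baseChange F).toAffine.Point →+ _).ker :=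
    natCard_invariants_torsion_restrictField W F hp.out.ne_zero
  have h2 : Nat.card (continuousCohomology 2 ρ.toTopRep) =
      Nat.card (nsmulAddMonoidHom p : (W.baseChange F).toAffine.Point →+ _).ker :=
    (natCard_galoisCohomology_two_torsion_restrictField W F p hp.out.isPrimePow).2
  change Nat.card (continuousCohomology 1 ρ.toTopRep) = _
  rw [← hEq, h0, h2, sq]

end Count

/-! ## §2 The local Weil cup product is SYMMETRIC, and transport of isotropy along `θ` -/

section Pairing

variable {K : Type u} [Field K] (W : WeierstrassCurve K) (n : ℕ) [NeZero n]
variable (e : geomTorsion W n → geomTorsion W n → AlgebraicClosure K)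
  (hμ : ∀ S T, e S T ^ n = 1)
  (hadd₁ : ∀ S₁ S₂ T, e (S₁ + S₂) T = e S₁ T * e S₂ T)
  (hadd₂ : ∀ S T₁ T₂, e S (T₁ + T₂) = e S T₁ * e S T₂)

/-- An alternating biadditive pairing is skew: `e(S, T) · e(T, S) = 1`, i.e. additively in
`MuCarrier`, `⟨S, T⟩ + ⟨T, S⟩ = 0` (expand `e(S + T, S + T) = 1`). Silverman, *AEC*, III.8.1 (b)⇒
skew-symmetry. [cite: SilvermanAEC2009, Prop. III.8.1] -/
theorem weilPairingHom_add_swap_eq_zero (halt : ∀ T, e T T = 1) (S T : geomTorsion W n) :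
    weilPairingHom W n e hμ hadd₁ hadd₂ S T + weilPairingHom W n e hμ hadd₁ hadd₂ T S = 0 := by
  have h := weilPairingHom_self W n e hμ hadd₁ hadd₂ halt (S + T)
  simp only [map_add, AddMonoidHom.add_apply, weilPairingHom_self W n e hμ hadd₁ hadd₂ halt S,
    weilPairingHom_self W n e hμ hadd₁ hadd₂ halt T, zero_add, add_zero] at h
  rwa [add_comm] at h

variable (F : Type u) [Field F] [Algebra K F] [LocallyCompactSpace (absoluteGaloisGroup F)]

/-- **The local Weil cup product `H¹(F, E[n]) × H¹(F, E[n]) → H²(F, μₙ)` is SYMMETRIC**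
(`x ∪ₑ y = y ∪ₑ x`) for an alternating `e`: graded commutativity in bidegree `(1,1)`
(`ContPairing.cupProduct_comm`: `x ∪ y = −(y ∪′ x)` for the flipped pairing) and the skewness of
`e` (`⟨T, S⟩ = −⟨S, T⟩`, so the flipped pairing is `−e`) — the two signs cancel, at the level of the
cocycles `(σ, τ) ↦ ⟨f σ, g(στ) − g σ⟩` (`ContPairing.cupCocycle_apply`). Poonen–Rains 2012, §4.1
(the pairing induced by `∪_{e_λ}` is symmetric). [cite: PoonenRains2012, Cor. 4.6 and Prop. 4.11]
[cite: NeukirchSchmidtWingberg2008, I §4 (1.4.4)] -/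
theorem weilCupProduct_comm
    (hgal : ∀ (σ : absoluteGaloisGroup K) (S T : geomTorsion W n), σ • e S T = e (σ • S) (σ • T))
    (halt : ∀ T, e T T = 1)
    (x y : galoisCohomology (GaloisRep.restrictField F (W.torsionGaloisModule n)) 1) :
    ((weilContPairing W n e hμ hadd₁ hadd₂ hgal).restrict (absGaloisRestrict K F)).cupProduct x y =
      ((weilContPairing W n e hμ hadd₁ hadd₂ hgal).restrict (absGaloisRestrict K F)).cupProduct y x := by
  set P := (weilContPairing W n e hμ hadd₁ hadd₂ hgal).restrict (absGaloisRestrict K F) with hP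
  obtain ⟨f, rfl⟩ := oneCocycleClass_surjective _ x
  obtain ⟨g, rfl⟩ := oneCocycleClass_surjective _ y
  rw [ContPairing.cupProduct_comm]
  erw [ContPairing.cupProduct_oneCocycleClass_eq_twoCocycleClass P.flip g f,
    ContPairing.cupProduct_oneCocycleClass_eq_twoCocycleClass P g f]
  rw [← twoCocycleClass_neg]
  congr 1
  rw [neg_eq_iff_eq_neg]
  refine Subtype.ext (ContinuousMap.ext fun q ↦ ?_)
  obtain ⟨σ, τ⟩ := q
  change (P.flip.cupCocycle g f).1 (σ, τ) = -((P.cupCocycle g f).1 (σ, τ))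
  rw [ContPairing.cupCocycle_apply, ContPairing.cupCocycle_apply, ContPairing.flip_toLin_apply,
    eq_neg_iff_add_eq_zero]
  exact weilPairingHom_add_swap_eq_zero W n e hμ hadd₁ hadd₂ halt _ _

end Pairing

/-! ## §3 `θ_* 𝓛_v(E′)` is isotropic for the Weil cup product of `E` -/

section Transport

variable {K : Type u} [Field K] [NumberField K] (W W' : WeierstrassCurve K) [W'.IsElliptic]
  (v : HeightOneSpectrum (𝓞 K)) {p : ℕ} [hp : Fact p.Prime]
variable (e : geomTorsion W p → geomTorsion W p → AlgebraicClosure K)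
  (hμ : ∀ S T, e S T ^ p = 1)
  (hadd₁ : ∀ S₁ S₂ T, e (S₁ + S₂) T = e S₁ T * e S₂ T)
  (hadd₂ : ∀ S T₁ T₂, e S (T₁ + T₂) = e S T₁ * e S T₂)
  (θ : geomTorsion W' (p : ℤ) ≃+ geomTorsion W (p : ℤ))
  (hθ : ∀ (σ : absoluteGaloisGroup K) (P : geomTorsion W' (p : ℤ)), θ (σ • P) = σ • θ P)

include hθ in
/-- **Transported Kummer classes of `E′` are ISOTROPIC for the Weil cup product of `E`.** Let
`θ : E′[p] ≃ E[p]` be `Γ_K`-equivariant, `f` a continuous `Γ_{K_v}`-intertwining map of the restricted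
torsion modules acting as `θ`, `e` an alternating equivariant `μ_p`-valued pairing on `E[p]`. For
`x′, y′ ∈ 𝓛_v(E′)`: `H¹(f) x′ ∪ₑ H¹(f) y′ = 0`. Proof: `e′ = e ∘ (θ × θ)` is an alternating
equivariant biadditive `μ_p`-valued pairing on `E′[p]`, so `𝓛_v(E′)` is isotropic for `∪_{e′}`
(the tree's discharged Poonen–Rains fact, `cupProduct_eq_zero_of_mem_kummerLocalConditionAt_of_fact`
with `kummerClass_cupProduct_kummerClass_eq_zero_holds`), and on representing cocycles
`(f∘φ) ∪ₑ (f∘ψ)` IS `φ ∪_{e′} ψ` (`ContPairing.cupCocycle_apply`, `muCarrier_eq_iff`).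
[cite: PoonenRains2012, Prop. 4.8 and Cor. 4.6] [cite: NeukirchSchmidtWingberg2008, I §4 (1.4.2)] -/
theorem cupProduct_map_map_eq_zero_of_mem_kummerLocalConditionAt
    [LocallyCompactSpace (absoluteGaloisGroup (v.adicCompletion K))]
    (hgal : ∀ (σ : absoluteGaloisGroup K) (S T : geomTorsion W p), σ • e S T = e (σ • S) (σ • T))
    (halt : ∀ T, e T T = 1)
    (f : (GaloisRep.restrictField (v.adicCompletion K)
        (W'.torsionGaloisModule (p : ℤ))).toContRepresentation →ⁱL
      (GaloisRep.restrictField (v.adicCompletion K)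
        (W.torsionGaloisModule (p : ℤ))).toContRepresentation)
    (hf : ∀ x, f x = θ x)
    {x' y' : galoisCohomology (GaloisRep.restrictField (v.adicCompletion K)
      (W'.torsionGaloisModule (p : ℤ))) 1}
    (hx' : x' ∈ W'.kummerLocalConditionAt (p : ℤ) (v.adicCompletion K))
    (hy' : y' ∈ W'.kummerLocalConditionAt (p : ℤ) (v.adicCompletion K)) :
    ((weilContPairing W p e hμ hadd₁ hadd₂ hgal).restrict
        (absGaloisRestrict K (v.adicCompletion K))).cupProduct
      (galoisCohomology.map f 1 x') (galoisCohomology.map f 1 y') = 0 := by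
  haveI : CharZero (v.adicCompletion K) := charZero_adicCompletion v
  haveI : NeZero p := ⟨hp.out.ne_zero⟩
  have hpZ : ((p : ℕ) : ℤ) ≠ 0 := by exact_mod_cast hp.out.ne_zero
  set F := v.adicCompletion K with hF
  -- the pulled-back pairing `e′ = e ∘ (θ × θ)` on `E′[p]`
  set e' : geomTorsion W' p → geomTorsion W' p → AlgebraicClosure K := fun S T ↦ e (θ S) (θ T)
    with he'
  have hμ' : ∀ S T, e' S T ^ p = 1 := fun S T ↦ hμ _ _
  have hadd₁' : ∀ S₁ S₂ T, e' (S₁ + S₂) T = e' S₁ T * e' S₂ T := fun S₁ S₂ T ↦ by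
    simp only [he', map_add]; exact hadd₁ _ _ _
  have hadd₂' : ∀ S T₁ T₂, e' S (T₁ + T₂) = e' S T₁ * e' S T₂ := fun S T₁ T₂ ↦ by
    simp only [he', map_add]; exact hadd₂ _ _ _
  have halt' : ∀ T, e' T T = 1 := fun T ↦ halt _
  have hgal' : ∀ (σ : absoluteGaloisGroup K) (S T : geomTorsion W' p),
      σ • e' S T = e' (σ • S) (σ • T) := fun σ S T ↦ by
    simp only [he']; rw [hθ, hθ]; exact hgal σ _ _
  set P := (weilContPairing W p e hμ hadd₁ hadd₂ hgal).restrict (absGaloisRestrict K F) with hP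
  set P' := (weilContPairing W' p e' hμ' hadd₁' hadd₂' hgal').restrict (absGaloisRestrict K F)
    with hP'
  obtain ⟨φ, rfl⟩ := oneCocycleClass_surjective _ x'
  obtain ⟨ψ, rfl⟩ := oneCocycleClass_surjective _ y'
  -- isotropy of `𝓛_v(E′)` for `e′` (Poonen–Rains, the tree's discharged fact)
  have hiso : P'.cupProduct (oneCocycleClass _ φ) (oneCocycleClass _ ψ) = 0 :=
    W'.cupProduct_eq_zero_of_mem_kummerLocalConditionAt_of_fact p e' hpZ
      (kummerClass_cupProduct_kummerClass_eq_zero_holds F) hμ' hadd₁' hadd₂' halt' hgal' hx' hy'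
  rw [galoisCohomology.map_one_oneCocycleClass, galoisCohomology.map_one_oneCocycleClass]
  erw [ContPairing.cupProduct_oneCocycleClass_eq_twoCocycleClass P] 
  erw [ContPairing.cupProduct_oneCocycleClass_eq_twoCocycleClass P'] at hiso
  rw [← hiso]
  congr 1
  refine Subtype.ext (ContinuousMap.ext fun q ↦ ?_)
  obtain ⟨σ, τ⟩ := q
  rw [ContPairing.cupCocycle_apply, ContPairing.cupCocycle_apply, contOneCocycles.pullback_apply,
    contOneCocycles.pullback_apply, contOneCocycles.pullback_apply]
  change weilPairingHom W p e hμ hadd₁ hadd₂ (f (φ.1 σ)) (f (ψ.1 (σ * τ)) - f (ψ.1 σ)) =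
    weilPairingHom W' p e' hμ' hadd₁' hadd₂' (φ.1 σ) (ψ.1 (σ * τ) - ψ.1 σ)
  rw [muCarrier_eq_iff, coe_weilPairingHom, coe_weilPairingHom, hf, hf, hf, he', ← map_sub]

end Transport

end TwoLagrangianLines

end Summit.BirchSwinnertonDyer.Rank1Residual.GaloisImage

end
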